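import Mathlib
import Literature.Combinatorics.Additive.TripleProductProperty
import Summits.MatrixMultiplication.MatrixMultiplication.Theorems.SnSubsetDichotomyThresholdSubsetTriplesPairFactorisation

/-!
# `SnSubsetDichotomy.ThresholdSubsetTriples`, line `interleaved-subsignature-ascent` — stub `stub_ownerPairNoThird` (explicit route)

Registered stub `stub_ownerPairNoThird` of crux `stmt-MatrixMultiplication-10882` (negative design rule of census
c3a): for every level set `L` the two OWNER chain classes `S_A = subsig (ownerSystem L)` and
`S_B = subsig (ownerSystem Lᶜ)` admit no third class with two elements — if `(S_A, S_B, U)` has the triple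
product property (Cohn–Umans 2003, Def. 2.1, tree `Literature.Combinatorics.Additive.TripleProductProperty`) then
`|U| ≤ 1`.

Explicit / elementary proof.  Only the ROOTED instances `s = 1`, `t' = 1` of the triple product property are
used (`card_le_one_of_rooted`): both owner classes contain the identity — the empty word, i.e. the identity
letter `swap k k` chosen at every level (private `one_mem_subsigBelow`, `one_mem_subsig_ownerSystem`) — and every
permutation `σ` is `a⁻¹ b` with `a ∈ S_A`, `b ∈ S_B` (surjectivity half of the landed exact pair factorisation
`stub_pairFactorisation`).  For `u, u' ∈ U` factor `u' u⁻¹ = a⁻¹ b`; then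
`1 · a⁻¹ · (b · 1⁻¹) · (u u'⁻¹) = u' u⁻¹ u u'⁻¹ = 1` is a TPP relation, whence `u = u'`.
Mathlib + the tree files imported; no new definitions.  Declarations live in the sub-namespace
`…Theorems.ThresholdSubsetTriples.OwnerPairNoThirdK2` (the bare name is taken by a sibling siege file); the chain
helpers are `private` local copies.
-/

-- `Summit.<Summit>.<Problem>` is the tree's mandated summit-side namespace; for this single-conjunct summit the
-- two components coincide, so the file silences `dupNamespace` (same as the vocabulary file it imports).
set_option linter.dupNamespace false
set_option autoImplicit false

namespace Summit.MatrixMultiplication.MatrixMultiplication.Theorems.ThresholdSubsetTriples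

open scoped Pointwise
open Literature.Combinatorics.Additive

namespace OwnerPairNoThirdK2

/-! ## The group-theoretic core: rooted relations of a covering pair kill the third class -/

/-- **Rooted relations suffice.**  Let `S, T, U` be finite subsets of a group with `1 ∈ S`, `1 ∈ T`, and suppose
every group element is `a⁻¹ b` with `a ∈ S`, `b ∈ T`.  If the ROOTED relations `a⁻¹ b (u u'⁻¹) = 1`
(`a ∈ S`, `b ∈ T`, `u, u' ∈ U`) force `u = u'`, then `|U| ≤ 1`.  (Explicit witness for `u ≠ u'`: factor
`u' u⁻¹ = a⁻¹ b`.) [folklore] -/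
theorem card_le_one_of_rooted {G : Type*} [Group G] {S T U : Finset G}
    (hsurj : ∀ σ : G, ∃ a ∈ S, ∃ b ∈ T, a⁻¹ * b = σ)
    (hroot : ∀ a ∈ S, ∀ b ∈ T, ∀ u ∈ U, ∀ u' ∈ U, a⁻¹ * b * (u * u'⁻¹) = 1 → u = u') :
    U.card ≤ 1 := by
  refine Finset.card_le_one.2 fun u hu u' hu' => ?_
  obtain ⟨a, ha, b, hb, hab⟩ := hsurj (u' * u⁻¹)
  refine hroot a ha b hb u hu u' hu' ?_
  rw [hab]
  group

/-- The rooted instances `s = 1`, `t' = 1` of the triple product property of `(S, T, U)`: with `1 ∈ S` and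
`1 ∈ T`, the TPP relation `1 · a⁻¹ · (b · 1⁻¹) · (u u'⁻¹) = 1` forces `u = u'`. [folklore; Cohn–Umans 2003,
Def. 2.1 specialised] -/
theorem rooted_of_tpp {G : Type*} [Group G] {S T U : Finset G} (h1S : (1 : G) ∈ S) (h1T : (1 : G) ∈ T)
    (hT : TripleProductProperty S T U) :
    ∀ a ∈ S, ∀ b ∈ T, ∀ u ∈ U, ∀ u' ∈ U, a⁻¹ * b * (u * u'⁻¹) = 1 → u = u' := by
  intro a ha b hb u hu u' hu' hrel
  have hrel' : 1 * a⁻¹ * (b * 1⁻¹) * (u * u'⁻¹) = 1 := by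
    rw [one_mul, inv_one, mul_one]
    exact hrel
  exact (hT 1 h1S a ha b hb 1 h1T u hu u' hu' hrel').2.2

/-! ## The identity word of a chain class -/

variable {n : ℕ}

/-- If every level of a system `D` carries its identity letter (`k ∈ D k`, encoding `swap k k = 1`), then the
identity permutation — the empty word — lies in every lower class `subsigBelow D m`. -/
private theorem one_mem_subsigBelow (D : Fin n → Finset (Fin n)) (hD : ∀ k : Fin n, k ∈ D k) :
    ∀ m : ℕ, (1 : Equiv.Perm (Fin n)) ∈ subsigBelow D m := by
  intro m
  induction m with
  | zero =>
    rw [subsigBelow_zero]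
    exact Finset.mem_singleton_self 1
  | succ m ih =>
    rw [subsigBelow_succ]
    have h1 : (1 : Equiv.Perm (Fin n)) ∈
        (if h : m < n then starPiece (D ⟨m, h⟩) ⟨m, h⟩ else ({1} : Finset (Equiv.Perm (Fin n)))) := by
      by_cases h : m < n
      · rw [dif_pos h]
        refine mem_starPiece.2 ⟨⟨m, h⟩, hD _, ?_⟩
        rw [Equiv.swap_self]
        rfl
      · rw [dif_neg h]
        exact Finset.mem_singleton_self 1
    simpa only [one_mul] using Finset.mul_mem_mul h1 ih

/-- Owner systems carry the identity letter at every level: `k ∈ ownerSystem L k` (the full direction set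
`{d ≤ k}` at owned levels, the singleton `{k}` elsewhere). -/
private theorem self_mem_ownerSystem (L : Finset (Fin n)) (k : Fin n) : k ∈ ownerSystem L k := by
  by_cases hk : k ∈ L
  · rw [ownerSystem_of_mem hk, Finset.mem_filter]
    exact ⟨Finset.mem_univ _, le_rfl⟩
  · rw [ownerSystem_of_not_mem hk]
    exact Finset.mem_singleton_self k

/-- The identity permutation lies in every owner chain class `subsig (ownerSystem L)`. -/
private theorem one_mem_subsig_ownerSystem (L : Finset (Fin n)) :
    (1 : Equiv.Perm (Fin n)) ∈ subsig (ownerSystem L) :=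
  one_mem_subsigBelow (ownerSystem L) (self_mem_ownerSystem L) n

/-- Surjectivity half of the exact pair factorisation (`stub_pairFactorisation`): every permutation is `a⁻¹ b`
with `a ∈ subsig (ownerSystem L)`, `b ∈ subsig (ownerSystem Lᶜ)`. -/
private theorem ownerPair_surj (L : Finset (Fin n)) (σ : Equiv.Perm (Fin n)) :
    ∃ a ∈ subsig (ownerSystem L), ∃ b ∈ subsig (ownerSystem Lᶜ), a⁻¹ * b = σ := by
  obtain ⟨⟨a, b⟩, ⟨ha, hb, hab⟩, -⟩ := stub_pairFactorisation L σ
  exact ⟨a, ha, b, hb, hab⟩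

/-- **Stub `stub_ownerPairNoThird` (census c3a, negative design rule; explicit route).**  If
`(subsig (ownerSystem L), subsig (ownerSystem Lᶜ), U)` has the triple product property then `|U| ≤ 1`:
both owner classes contain the identity word and the pair covers `S_n` by `a⁻¹ b`
(`stub_pairFactorisation`), so for `u, u' ∈ U` the rooted TPP relation `1 · a⁻¹ · (b · 1⁻¹) · (u u'⁻¹) = 1`
with `a⁻¹ b = u' u⁻¹` forces `u = u'`. -/
theorem stub_ownerPairNoThird {n : ℕ} (L : Finset (Fin n)) (U : Finset (Equiv.Perm (Fin n))) (hT : TripleProductProperty (subsig (ownerSystem L)) (subsig (ownerSystem Lᶜ)) U) : U.card ≤ 1 :=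
  card_le_one_of_rooted (ownerPair_surj L)
    (rooted_of_tpp (one_mem_subsig_ownerSystem L) (one_mem_subsig_ownerSystem Lᶜ) hT)

end OwnerPairNoThirdK2

end Summit.MatrixMultiplication.MatrixMultiplication.Theorems.ThresholdSubsetTriples
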